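import Summits.BirchSwinnertonDyer.BirchSwinnertonDyer.Theorems.PrintCf2SplitBadTwoDualPairKernel
import Summits.BirchSwinnertonDyer.BirchSwinnertonDyer.Theorems.PrintCf2RubinValueTwoLinePushSpecialisation
import Summits.BirchSwinnertonDyer.BirchSwinnertonDyer.Theorems.PrintCf2SplitBadTwoRestrictedSelmerLeadingTerm
import Summits.BirchSwinnertonDyer.BirchSwinnertonDyer.Theorems.PrintCf2SplitBadTwoLineUnrSelmerTransport
import Literature.NumberTheory.EllipticCurves.IwasawaDualFunctorialityProofs
import HarnessLib

/-!
# Crux `PrintCf2.SplitBadTwoRankOneOfFacts` (stmt-BirchSwinnertonDyer-20368), skeleton v12.1, stub S3d `stub_strictDefectAtVbar_two` —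
# the ALGEBRAIC SPINE, part II: Agboola's STRICT datum from the Greenberg–Vatsal UNRAMIFIED datum on the line, and
# `ord_p H'(0) = ord_p H(0) + χ_Γ(S_nr ⧸ 𝔖)` (generic `K`, `p`, `M`, line `κ`, place `𝔮`; fact-free), plus the CM-summand instance

Cell `bsd-print-cf2`, EXTRA WIDTH seat `bsd-line-cf2-p1-w3` g11 (prover-bsd-line-cf2-p1-w3-g11-0); `--supports stmt-BirchSwinnertonDyer-20368`
(helper, Theses-free). HONEST FRAMING: nothing here closes the crux or the registered stub S3d; BSD is not proved by any of this; no summit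
statement is proved by this seat. No definition, no named fact, no `sorry`. Sequel of `PrintCf2SplitBadTwoDualPairKernel` (part I, pure algebra).

WHAT. On a `ℤ_p`-line `κ` with topological generator `γ`, for a discrete `p`-primary `M` with open stabilisers and a place `𝔮`, Agboola's
restricted group `𝔖 := 𝔖_𝔮(K_∞, M) = Agboola2007.restrictedSelmerZp κ M 𝔮` (STRICT above `𝔮`, locally trivial away from `p`) sits inside the
Greenberg–Vatsal / Keller–Yin unramified group `S_nr := unrSelmer κ M 𝔮 ∅` (UNRAMIFIED above `𝔮` and away from `p`, nothing at the other primes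
over `p`) — -w6 g4 `LineTransport.restrictedSelmerZp_le_datumSelmer`. Let `Q := S_nr ⧸ 𝔖` with the endomorphism `ψ_Q` induced by `conj_γ − 1`.
* §3 **`exists_surjective_linearMap_restricted_of_unr`** — for ANY `Dnr : DatumDualData κ γ M (bdpData M p 𝔮) ∅` and ANY
  `D : RestrictedDualData κ M 𝔮 γ` the transpose of `𝔖 ≤ S_nr` is a SURJECTIVE `Λ`-linear `Dnr.X →ₗ[Λ] D.X` (`IsDualPair.exists_linearMap_comp_surjective`
  on cf2c-w8 `LinePush.isDualPair_unr` and `Agboola2007.RestrictedDualData.isDualPair`) whose kernel is a dual pair for `(Q, ψ_Q)` (part I);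
  the S3d read-out **`hasCharValuationAt_restricted_of_unr`**: if `Dnr.X` is finitely generated torsion with `char = (H')`, `H'(0) ≠ 0`, then `D.X` is
  finitely generated, `D.HasCharValuationAt n` (`n = ord_p H(0)`), `Q^{ψ_Q}` and `Q_{ψ_Q}` are finite, `v_p #Q^{ψ_Q} = e + v_p #Q_{ψ_Q}` and
  **`ord_p H'(0) = n + e`** (Greenberg's Lemma 4.2 on the kernel pair); ∃-form over the canonical datum **`exists_restrictedDualData_of_unr`**;
  FINITE defect ⟹ `e = 0`: **`hasCharValuationAt_restricted_of_unr_of_finite`** (`n' = n`, -w6 g4's classes (i)/(ii)).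
* §4 the CM summand `W* = V.endEigenPrimaryTorsion p π r` (any number field, any `V`, `π`, `r`): `htor`/`hstab` discharged by -w7's
  `RestrictedSelmerPair.exists_pow_smul_endEigenPrimaryTorsion_eq_zero` / `isOpen_stabilizer_endEigenPrimaryTorsion` —
  **`exists_restrictedDualData_of_unr_endEigenPrimaryTorsion`**, **`hasCharValuationAt_restricted_of_unr_endEigenPrimaryTorsion`**.
* §5 THE SOCKET for the arithmetic half: **`natCard_endInvariants_congr`** (invariants/coinvariants counts along an equivariant `Q ≃+ Q'`) and
  **`hasCharValuationAt_restricted_of_unr_of_addEquiv`** — given an equivariant `e : S_nr ⧸ 𝔖 ≃+ 𝓗` (GV Cor. 2.3 shape, -w7 g5 / -w8 g4 (DC)),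
  `ord_p H'(0) = n + (log_p #𝓗^Γ − log_p #𝓗_Γ)` — -w6 g4's local count finishes S3d.
CONSEQUENCE for S3d (`Lines/rubin_value_two_lead_v12_1.lean`): its `∃ D n, Module.Finite ∧ HasCharValuationAt n ∧ n' = n + e_δ` holds on every frame
with `e_δ := χ_Γ(Q) = log_p #Q^Γ − log_p #Q_Γ`, WITHOUT (FIN) (the stub's `H'(0) ≠ 0` is a hypothesis); what is left of S3d is the ARITHMETIC
class-uniformity of `χ_Γ(Q)` (LEAD 02:08:52Z / 02:16:44Z: (LS) ⟹ `Q = ⊕_{𝔓∣v̄} H¹_nr/H¹_str` [-w7 g5], `Q_Γ = 0` on class (iii) [-w4 g11 (B)],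
the local count [-w6 g4]; classes (i)/(ii): `Q` finite [-w6 g4] ⟹ `e_δ = 0` by `…_of_finite`).
presearch: Greenberg–Vatsal 2000 §2 Cor. 2.3 / Greenberg 2016 Prop. 2.5.1 (tree: `Greenberg2016.Specification.nonempty_selmerQuotEquivPi`) — the
source pattern; Greenberg LNM 1716 Lemma 4.2 — tree theorems; no new fact. beyond-print theorem: no.

References: [GreenbergVatsal2000] §2 pp. 17–21 (Cor. 2.3); [GreenbergLNM1716] §1 p. 60, §4 Lemma 4.2; [Agboola2007] §3 Prop. 3.2, §5;
[Greenberg1989] §1 p. 98.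
-/

noncomputable section

open scoped Classical
-- the summit namespace `Summit.BirchSwinnertonDyer.BirchSwinnertonDyer` repeats the problem name by design (D-0017)
set_option linter.dupNamespace false
set_option autoImplicit false

open NumberField IsDedekindDomain Field
open Literature.NumberTheory.EllipticCurves Literature.NumberTheory.EllipticCurves.GreenbergSelmer
open Literature.NumberTheory.EllipticCurves.GreenbergVatsal2000 Literature.NumberTheory.EllipticCurves.KellerYin2024
open Literature.NumberTheory.EllipticCurves.Agboola2007
open Literature.NumberTheory.EllipticCurves.IwasawaAlgebra Literature.NumberTheory.EllipticCurves.IwasawaDual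
open Literature.NumberTheory.GaloisRepresentations

universe u

namespace Summit.BirchSwinnertonDyer.BirchSwinnertonDyer.Theorems.PrintCf2.StrictDefect

/-! ## §3. The line: Agboola's strict datum from the Greenberg–Vatsal unramified datum, and `ord_p H'(0) = n + χ_Γ(S_nr ⧸ 𝔖)` -/

section Line

variable {K : Type u} [Field K] [NumberField K] {p : ℕ} [Fact p.Prime] {κ : ZpExtension K p}
  {M : Type u} [AddCommGroup M] [DistribMulAction (absoluteGaloisGroup K) M] [TopologicalSpace M] [DiscreteTopology M]
  {𝔮 : HeightOneSpectrum (𝓞 K)} {γ : absoluteGaloisGroup K}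

variable (κ M 𝔮) in
/-- **`𝔖_𝔮(K_∞, M) ≤ H¹_{𝓕_nr}(K_∞, M)`** (strict ⟹ unramified above `𝔮`, locally trivial ⟹ unramified away from `p`): -w6 g4's
`LineTransport.restrictedSelmerZp_le_datumSelmer`, read in the `unrSelmer` spelling. [cite: Greenberg1989, §1 p. 98] [cite: Agboola2007, §3 Prop. 3.2] -/
theorem restrictedSelmerZp_le_unrSelmer : restrictedSelmerZp κ M 𝔮 ≤ unrSelmer κ M 𝔮 ∅ :=
  LineTransport.restrictedSelmerZp_le_datumSelmer (κ₂ := κ) (M := M) (p := p) 𝔮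

variable (κ M 𝔮) in
/-- The subgroup `𝔖 ≤ S_nr` is stable under `conj_γ − 1` (both groups are `Γ_K`-stable in `H¹(K_∞, M)`), so `conj_γ − 1` descends to
`Q = S_nr ⧸ 𝔖`. [cite: Agboola2007, §3 (arXiv p0008:L76–80)] [cite: GreenbergVatsal2000, §2 p. 17] -/
theorem addSubgroupOf_le_comap_conjUnr_sub_one (γ : absoluteGaloisGroup K) :
    (restrictedSelmerZp κ M 𝔮).addSubgroupOf (unrSelmer κ M 𝔮 ∅) ≤
      ((restrictedSelmerZp κ M 𝔮).addSubgroupOf (unrSelmer κ M 𝔮 ∅)).comap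
        ((conjUnr κ M 𝔮 ∅ γ - 1 : AddMonoid.End (unrSelmer κ M 𝔮 ∅)) : unrSelmer κ M 𝔮 ∅ →+ unrSelmer κ M 𝔮 ∅) := by
  intro s hs
  rw [AddSubgroup.mem_comap, AddSubgroup.mem_addSubgroupOf]
  rw [AddSubgroup.mem_addSubgroupOf] at hs
  change ((conjUnr κ M 𝔮 ∅ γ s - s : unrSelmer κ M 𝔮 ∅) : subgroupH1 κ.kerSubgroup M) ∈ restrictedSelmerZp κ M 𝔮
  rw [AddSubgroupClass.coe_sub]
  exact sub_mem (conjH1_mem_restrictedSelmerZp κ M 𝔮 γ hs) hs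

/-- **The transpose of `𝔖 ≤ S_nr` is onto, and its kernel is dual to `Q = S_nr ⧸ 𝔖`.** For ANY Greenberg–Vatsal datum `Dnr` of
`S_nr = H¹_{𝓕_nr}(K_∞, M)` and ANY Agboola datum `D` of `𝔖 = 𝔖_𝔮(K_∞, M)` (`M` `p`-primary with open stabilisers, `γ` a topological generator):
a SURJECTIVE `Λ`-linear `F : Dnr.X → D.X` with `D.toDual (F x) = Dnr.toDual x |_𝔖` (`IsDualPair.exists_linearMap_comp_surjective` on
cf2c-w8 `LinePush.isDualPair_unr` and `Agboola2007.RestrictedDualData.isDualPair`), whose kernel is a dual pair for `(Q, ψ_Q)`,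
`ψ_Q` induced by `conj_γ − 1` (`exists_isDualPair_ker`). Dual of GV's `0 → S_A → S^{Σ₀}_A → S^{Σ₀}_A/S_A → 0`.
[cite: GreenbergVatsal2000, §2 pp. 17, 20–21] [cite: GreenbergLNM1716, §1 p. 60] -/
theorem exists_surjective_linearMap_restricted_of_unr (htor : ∀ m : M, ∃ k : ℕ, p ^ k • m = 0)
    (hstab : ∀ m : M, IsOpen (MulAction.stabilizer (absoluteGaloisGroup K) m : Set (absoluteGaloisGroup K)))
    (hγ : κ.IsTopGenerator γ) (Dnr : DatumDualData κ γ M (Castella2018.AcSelmer.bdpData M p 𝔮) ∅)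
    (D : RestrictedDualData κ M 𝔮 γ) :
    ∃ (F : Dnr.X →ₗ[IwasawaAlgebra p] D.X)
      (toDualK : LinearMap.ker F →+
        (unrSelmer κ M 𝔮 ∅ ⧸ (restrictedSelmerZp κ M 𝔮).addSubgroupOf (unrSelmer κ M 𝔮 ∅) →+ AddCircle (1 : ℚ))),
      Function.Surjective F ∧
      (∀ (x : Dnr.X) (s : restrictedSelmerZp κ M 𝔮),
        D.toDual (F x) s = Dnr.toDual x (AddSubgroup.inclusion (restrictedSelmerZp_le_unrSelmer κ M 𝔮) s)) ∧
      IsDualPair p (QuotientAddGroup.map _ _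
        ((conjUnr κ M 𝔮 ∅ γ - 1 : AddMonoid.End (unrSelmer κ M 𝔮 ∅)) : unrSelmer κ M 𝔮 ∅ →+ unrSelmer κ M 𝔮 ∅)
        (addSubgroupOf_le_comap_conjUnr_sub_one κ M 𝔮 γ)) toDualK ∧
      ∀ (x : LinearMap.ker F) (s : unrSelmer κ M 𝔮 ∅), toDualK x (QuotientAddGroup.mk s) = Dnr.toDual (x : Dnr.X) s := by
  have hnr := LinePush.isDualPair_unr Dnr htor hstab hγ
  have hres := D.isDualPair htor hstab hγ
  set φ : restrictedSelmerZp κ M 𝔮 →+ unrSelmer κ M 𝔮 ∅ := AddSubgroup.inclusion (restrictedSelmerZp_le_unrSelmer κ M 𝔮) with hφdef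
  have hφ : ∀ s, φ ((conjRestricted κ M 𝔮 γ - 1) s) = (conjUnr κ M 𝔮 ∅ γ - 1) (φ s) := fun s ↦ rfl
  obtain ⟨F, hFsurj, hF⟩ := hnr.exists_linearMap_comp_surjective hres φ hφ
    (AddSubgroup.inclusion_injective (restrictedSelmerZp_le_unrSelmer κ M 𝔮))
  obtain ⟨toDualK, hK, hKapply⟩ := exists_isDualPair_ker p hnr hres φ F hF
    ((restrictedSelmerZp κ M 𝔮).addSubgroupOf (unrSelmer κ M 𝔮 ∅)) (AddSubgroup.inclusion_range _).symm
    (QuotientAddGroup.map _ _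
        ((conjUnr κ M 𝔮 ∅ γ - 1 : AddMonoid.End (unrSelmer κ M 𝔮 ∅)) : unrSelmer κ M 𝔮 ∅ →+ unrSelmer κ M 𝔮 ∅)
        (addSubgroupOf_le_comap_conjUnr_sub_one κ M 𝔮 γ)) (fun _ ↦ rfl)
  exact ⟨F, toDualK, hFsurj, hF, hK, hKapply⟩

/-- **S3d ALGEBRAIC SPINE — `ord_p H'(0) = n + χ_Γ(S_nr ⧸ 𝔖)` for ANY Agboola datum `D`.** On a `ℤ_p`-line `κ` with generator `γ`, `M` `p`-primary
with open stabilisers, place `𝔮`: if SOME Greenberg–Vatsal datum `Dnr` of `S_nr = H¹_{𝓕_nr}(K_∞, M)` is finitely generated and torsion over `Λ`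
with `char = (H')`, `H'(0) ≠ 0`, then for EVERY `D : RestrictedDualData κ M 𝔮 γ`: `D.X` is finitely generated, `D.HasCharValuationAt n`
(`n = ord_p H(0)` for a generator `H` of `char D.X`), the `ψ_Q`-invariants and -coinvariants of `Q = S_nr ⧸ 𝔖` are FINITE,
`v_p #Q^{ψ_Q} = e + v_p #Q_{ψ_Q}` and **`ord_p H'(0) = n + e`** — `e = χ_Γ(Q)`, the Euler characteristic of the strict/unramified defect
(transpose `F` onto, `char Dnr.X = char (ker F) · char D.X`, Greenberg's Lemma 4.2 `H_K(0) · #Q_Γ = u · #Q^Γ` on the kernel pair). This is the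
`∃ D n` clause and the shape `n' = n + e_δ` of S3d `stub_strictDefectAtVbar_two` with `e_δ := χ_Γ(Q)`, leaving only the class-uniformity of
`χ_Γ(Q)` (GV Cor. 2.3: `Q ≅ ⊕_{𝔓∣v̄} H¹_nr/H¹_str` under surjectivity, then a local count).
[cite: GreenbergVatsal2000, §2 Cor. 2.3 (pp. 20–21)] [cite: GreenbergLNM1716, §4 Lemma 4.2 (pp. 102–103)] [cite: Agboola2007, §5 (arXiv p0012:L8–16)] -/
theorem hasCharValuationAt_restricted_of_unr (htor : ∀ m : M, ∃ k : ℕ, p ^ k • m = 0)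
    (hstab : ∀ m : M, IsOpen (MulAction.stabilizer (absoluteGaloisGroup K) m : Set (absoluteGaloisGroup K)))
    (hγ : κ.IsTopGenerator γ) (Dnr : DatumDualData κ γ M (Castella2018.AcSelmer.bdpData M p 𝔮) ∅)
    [Module.Finite (IwasawaAlgebra p) Dnr.X] (hXtor : Module.IsTorsion (IwasawaAlgebra p) Dnr.X) {H' : IwasawaAlgebra p}
    (hH' : Module.charIdeal (IwasawaAlgebra p) Dnr.X = Ideal.span {H'}) (hH'0 : PowerSeries.constantCoeff H' ≠ 0)
    (D : RestrictedDualData κ M 𝔮 γ) :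
    Module.Finite (IwasawaAlgebra p) D.X ∧
    ∃ (n e : ℕ), D.HasCharValuationAt n ∧
      Finite (endInvariants (QuotientAddGroup.map _ _
        ((conjUnr κ M 𝔮 ∅ γ - 1 : AddMonoid.End (unrSelmer κ M 𝔮 ∅)) : unrSelmer κ M 𝔮 ∅ →+ unrSelmer κ M 𝔮 ∅)
        (addSubgroupOf_le_comap_conjUnr_sub_one κ M 𝔮 γ))) ∧
      Finite (EndCoinvariants (QuotientAddGroup.map _ _
        ((conjUnr κ M 𝔮 ∅ γ - 1 : AddMonoid.End (unrSelmer κ M 𝔮 ∅)) : unrSelmer κ M 𝔮 ∅ →+ unrSelmer κ M 𝔮 ∅)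
        (addSubgroupOf_le_comap_conjUnr_sub_one κ M 𝔮 γ))) ∧
      padicValNat p (Nat.card (endInvariants (QuotientAddGroup.map _ _
        ((conjUnr κ M 𝔮 ∅ γ - 1 : AddMonoid.End (unrSelmer κ M 𝔮 ∅)) : unrSelmer κ M 𝔮 ∅ →+ unrSelmer κ M 𝔮 ∅)
        (addSubgroupOf_le_comap_conjUnr_sub_one κ M 𝔮 γ)))) =
        e + padicValNat p (Nat.card (EndCoinvariants (QuotientAddGroup.map _ _
          ((conjUnr κ M 𝔮 ∅ γ - 1 : AddMonoid.End (unrSelmer κ M 𝔮 ∅)) : unrSelmer κ M 𝔮 ∅ →+ unrSelmer κ M 𝔮 ∅)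
          (addSubgroupOf_le_comap_conjUnr_sub_one κ M 𝔮 γ)))) ∧
      (PowerSeries.constantCoeff H').valuation = n + e := by
  obtain ⟨F, toDualK, hFsurj, -, hK, -⟩ := exists_surjective_linearMap_restricted_of_unr htor hstab hγ Dnr D
  haveI : IsNoetherian (IwasawaAlgebra p) Dnr.X := isNoetherian_of_isNoetherianRing_of_finite _ _
  have hfinD : Module.Finite (IwasawaAlgebra p) D.X := Module.Finite.of_surjective F hFsurj
  -- torsion passes to the image and to the kernel
  have hDtor : Module.IsTorsion (IwasawaAlgebra p) D.X := fun y ↦ by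
    obtain ⟨x, rfl⟩ := hFsurj y
    obtain ⟨a, ha⟩ := @hXtor x
    exact ⟨a, by rw [Submonoid.smul_def, ← map_smul, ← Submonoid.smul_def, ha, map_zero]⟩
  have hKtor : Module.IsTorsion (IwasawaAlgebra p) (LinearMap.ker F) := fun x ↦ by
    obtain ⟨a, ha⟩ := @hXtor (x : Dnr.X)
    exact ⟨a, Subtype.ext (by rw [Submonoid.smul_def, Submodule.coe_smul, ← Submonoid.smul_def, ha, ZeroMemClass.coe_zero])⟩
  obtain ⟨HK, H, hHK, hH, hHK0, hH0, hval⟩ := exists_charGenerators_of_surjective hXtor F hFsurj hH' hH'0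
  -- Greenberg's Lemma 4.2 on the kernel pair
  obtain ⟨hinvK, hcoinvK⟩ := RestrictedSelmerPair.finite_coinvariants_of_constantCoeff_ne_zero (LinearMap.ker F) hKtor HK hHK hHK0
  have hfinI := hK.finite_coinvariants_iff.mp hcoinvK
  have hfinC := hK.finite_invariants_iff.mp hinvK
  obtain ⟨u, hu⟩ := hK.constantCoeff_charGenerator_mul_natCard_endCoinvariants hKtor HK hHK hfinI
  haveI := hfinI; haveI := hfinC
  have hI : Nat.card (endInvariants (QuotientAddGroup.map _ _
      ((conjUnr κ M 𝔮 ∅ γ - 1 : AddMonoid.End (unrSelmer κ M 𝔮 ∅)) : unrSelmer κ M 𝔮 ∅ →+ unrSelmer κ M 𝔮 ∅)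
      (addSubgroupOf_le_comap_conjUnr_sub_one κ M 𝔮 γ))) ≠ 0 := Nat.card_pos.ne'
  have hC : Nat.card (EndCoinvariants (QuotientAddGroup.map _ _
      ((conjUnr κ M 𝔮 ∅ γ - 1 : AddMonoid.End (unrSelmer κ M 𝔮 ∅)) : unrSelmer κ M 𝔮 ∅ →+ unrSelmer κ M 𝔮 ∅)
      (addSubgroupOf_le_comap_conjUnr_sub_one κ M 𝔮 γ))) ≠ 0 := Nat.card_pos.ne'
  have e := RestrictedSelmerPair.padicValNat_eq_of_mul_natCast_eq hC hI hHK0 hu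
  refine ⟨hfinD, (PowerSeries.constantCoeff H).valuation, (PowerSeries.constantCoeff HK).valuation, ?_, hfinI, hfinC, ?_, ?_⟩
  · exact RestrictedDualData.hasCharValuationAt_of_eq hDtor hH hH0 rfl
  · omega
  · rw [hval, add_comm]

/-- **S3d ALGEBRAIC SPINE, ∃-form over the canonical datum.** Same hypotheses; conclusion: THERE IS an Agboola datum `D` (the canonical
`Agboola2007.restrictedDualData`, `X = Hom(𝔖, ℚ/ℤ)`) with `Module.Finite`, `D.HasCharValuationAt n`, and `ord_p H'(0) = n + e`,
`v_p #Q^{ψ_Q} = e + v_p #Q_{ψ_Q}`, both groups finite — the `∃ (D) (n)` clause of `stub_strictDefectAtVbar_two` with `e_δ := χ_Γ(S_nr ⧸ 𝔖)`.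
[cite: GreenbergVatsal2000, §2 Cor. 2.3 (pp. 20–21)] [cite: GreenbergLNM1716, §4 Lemma 4.2] [cite: Agboola2007, §1 p. 2, §5] -/
theorem exists_restrictedDualData_of_unr (htor : ∀ m : M, ∃ k : ℕ, p ^ k • m = 0)
    (hstab : ∀ m : M, IsOpen (MulAction.stabilizer (absoluteGaloisGroup K) m : Set (absoluteGaloisGroup K)))
    (hγ : κ.IsTopGenerator γ) (Dnr : DatumDualData κ γ M (Castella2018.AcSelmer.bdpData M p 𝔮) ∅)
    [Module.Finite (IwasawaAlgebra p) Dnr.X] (hXtor : Module.IsTorsion (IwasawaAlgebra p) Dnr.X) {H' : IwasawaAlgebra p}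
    (hH' : Module.charIdeal (IwasawaAlgebra p) Dnr.X = Ideal.span {H'}) (hH'0 : PowerSeries.constantCoeff H' ≠ 0) :
    ∃ (D : RestrictedDualData κ M 𝔮 γ) (n e : ℕ), Module.Finite (IwasawaAlgebra p) D.X ∧ D.HasCharValuationAt n ∧
      Finite (endInvariants (QuotientAddGroup.map _ _
        ((conjUnr κ M 𝔮 ∅ γ - 1 : AddMonoid.End (unrSelmer κ M 𝔮 ∅)) : unrSelmer κ M 𝔮 ∅ →+ unrSelmer κ M 𝔮 ∅)
        (addSubgroupOf_le_comap_conjUnr_sub_one κ M 𝔮 γ))) ∧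
      Finite (EndCoinvariants (QuotientAddGroup.map _ _
        ((conjUnr κ M 𝔮 ∅ γ - 1 : AddMonoid.End (unrSelmer κ M 𝔮 ∅)) : unrSelmer κ M 𝔮 ∅ →+ unrSelmer κ M 𝔮 ∅)
        (addSubgroupOf_le_comap_conjUnr_sub_one κ M 𝔮 γ))) ∧
      padicValNat p (Nat.card (endInvariants (QuotientAddGroup.map _ _
        ((conjUnr κ M 𝔮 ∅ γ - 1 : AddMonoid.End (unrSelmer κ M 𝔮 ∅)) : unrSelmer κ M 𝔮 ∅ →+ unrSelmer κ M 𝔮 ∅)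
        (addSubgroupOf_le_comap_conjUnr_sub_one κ M 𝔮 γ)))) =
        e + padicValNat p (Nat.card (EndCoinvariants (QuotientAddGroup.map _ _
          ((conjUnr κ M 𝔮 ∅ γ - 1 : AddMonoid.End (unrSelmer κ M 𝔮 ∅)) : unrSelmer κ M 𝔮 ∅ →+ unrSelmer κ M 𝔮 ∅)
          (addSubgroupOf_le_comap_conjUnr_sub_one κ M 𝔮 γ)))) ∧
      (PowerSeries.constantCoeff H').valuation = n + e := by
  obtain ⟨hfin, n, e, h1, h2, h3, h4, h5⟩ :=
    hasCharValuationAt_restricted_of_unr htor hstab hγ Dnr hXtor hH' hH'0 (restrictedDualData κ 𝔮 htor hstab hγ)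
  exact ⟨restrictedDualData κ 𝔮 htor hstab hγ, n, e, hfin, h1, h2, h3, h4, h5⟩

/-- **A FINITE defect does not move the valuation: `Finite (S_nr ⧸ 𝔖) ⟹ ord_p H'(0) = n`** (`= ord_p H(0)` for Agboola's datum). Same
hypotheses as `hasCharValuationAt_restricted_of_unr` plus `Finite Q`; then `#Q^{ψ_Q} = #Q_{ψ_Q}` (`natCard_endInvariants_eq_of_finite`), so `e = 0`:
the S3d conclusion `n' = n + 0` of -w6 g4's classes (i)/(ii) (`Def(v̄)` finite) from the Euler characteristic, with NO identification of `Q`.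
[cite: GreenbergVatsal2000, §2 Cor. 2.3 (pp. 20–21)] [cite: GreenbergLNM1716, §4 Lemma 4.2] -/
theorem hasCharValuationAt_restricted_of_unr_of_finite (htor : ∀ m : M, ∃ k : ℕ, p ^ k • m = 0)
    (hstab : ∀ m : M, IsOpen (MulAction.stabilizer (absoluteGaloisGroup K) m : Set (absoluteGaloisGroup K)))
    (hγ : κ.IsTopGenerator γ) (Dnr : DatumDualData κ γ M (Castella2018.AcSelmer.bdpData M p 𝔮) ∅)
    [Module.Finite (IwasawaAlgebra p) Dnr.X] (hXtor : Module.IsTorsion (IwasawaAlgebra p) Dnr.X) {H' : IwasawaAlgebra p}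
    (hH' : Module.charIdeal (IwasawaAlgebra p) Dnr.X = Ideal.span {H'}) (hH'0 : PowerSeries.constantCoeff H' ≠ 0)
    (hQ : Finite (unrSelmer κ M 𝔮 ∅ ⧸ (restrictedSelmerZp κ M 𝔮).addSubgroupOf (unrSelmer κ M 𝔮 ∅)))
    (D : RestrictedDualData κ M 𝔮 γ) :
    Module.Finite (IwasawaAlgebra p) D.X ∧ D.HasCharValuationAt (PowerSeries.constantCoeff H').valuation := by
  obtain ⟨hfin, n, e, h1, -, -, h4, h5⟩ := hasCharValuationAt_restricted_of_unr htor hstab hγ Dnr hXtor hH' hH'0 D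
  haveI := hQ
  rw [natCard_endInvariants_eq_of_finite] at h4
  have he : e = 0 := by omega
  rw [he, add_zero] at h5
  rw [h5]
  exact ⟨hfin, h1⟩

end Line

/-! ## §4. The CM summand `W* = E[𝔮*^∞]` (side conditions discharged): the shape consumed by S3d's frames -/

section Summand

variable {K : Type u} [Field K] [NumberField K] (V : WeierstrassCurve K) {p : ℕ} [Fact p.Prime] (π : V.endRing) (r : ℤ_[p])
  {κ : ZpExtension K p} {𝔮 : HeightOneSpectrum (𝓞 K)} {γ : absoluteGaloisGroup K}

/-- **S3d ALGEBRAIC SPINE for the CM summand `W* = V.endEigenPrimaryTorsion p π r`** (any number field `K`, any `V`, `p`, `π`, `r`, any line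
`κ'` with generator `γ'`, any place `𝔮` — the binders of `stub_strictDefectAtVbar_two` specialise these): `htor`/`hstab` of
`hasCharValuationAt_restricted_of_unr` discharged by -w7's `RestrictedSelmerPair.exists_pow_smul_endEigenPrimaryTorsion_eq_zero` /
`isOpen_stabilizer_endEigenPrimaryTorsion`. GIVEN a Greenberg–Vatsal datum `Dnr` of `S_{W*}(K'_∞)` (finitely generated, torsion, `char = (H')`,
`H'(0) ≠ 0` — the output shape of S3b′-v12), THERE ARE an Agboola datum `D` of `𝔖_𝔮(K'_∞, W*)` and `n e : ℕ` with `Module.Finite D.X`,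
`D.HasCharValuationAt n`, `Q^{ψ_Q}`, `Q_{ψ_Q}` finite (`Q = S_{W*}(K'_∞) ⧸ 𝔖`), `v_p #Q^{ψ_Q} = e + v_p #Q_{ψ_Q}`, and `ord_p H'(0) = n + e`.
[cite: GreenbergVatsal2000, §2 Cor. 2.3 (pp. 20–21)] [cite: GreenbergLNM1716, §4 Lemma 4.2] [cite: Agboola2007, §3 Prop. 3.2, §5] -/
theorem exists_restrictedDualData_of_unr_endEigenPrimaryTorsion (hγ : κ.IsTopGenerator γ)
    (Dnr : DatumDualData κ γ ↥(V.endEigenPrimaryTorsion p π r)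
      (Castella2018.AcSelmer.bdpData ↥(V.endEigenPrimaryTorsion p π r) p 𝔮) ∅)
    [Module.Finite (IwasawaAlgebra p) Dnr.X] (hXtor : Module.IsTorsion (IwasawaAlgebra p) Dnr.X) {H' : IwasawaAlgebra p}
    (hH' : Module.charIdeal (IwasawaAlgebra p) Dnr.X = Ideal.span {H'}) (hH'0 : PowerSeries.constantCoeff H' ≠ 0) :
    ∃ (D : RestrictedDualData κ ↥(V.endEigenPrimaryTorsion p π r) 𝔮 γ) (n e : ℕ),
      Module.Finite (IwasawaAlgebra p) D.X ∧ D.HasCharValuationAt n ∧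
      Finite (endInvariants (QuotientAddGroup.map _ _
        ((conjUnr κ ↥(V.endEigenPrimaryTorsion p π r) 𝔮 ∅ γ - 1 : AddMonoid.End (unrSelmer κ ↥(V.endEigenPrimaryTorsion p π r) 𝔮 ∅)) :
          unrSelmer κ ↥(V.endEigenPrimaryTorsion p π r) 𝔮 ∅ →+ unrSelmer κ ↥(V.endEigenPrimaryTorsion p π r) 𝔮 ∅)
        (addSubgroupOf_le_comap_conjUnr_sub_one κ ↥(V.endEigenPrimaryTorsion p π r) 𝔮 γ))) ∧
      Finite (EndCoinvariants (QuotientAddGroup.map _ _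
        ((conjUnr κ ↥(V.endEigenPrimaryTorsion p π r) 𝔮 ∅ γ - 1 : AddMonoid.End (unrSelmer κ ↥(V.endEigenPrimaryTorsion p π r) 𝔮 ∅)) :
          unrSelmer κ ↥(V.endEigenPrimaryTorsion p π r) 𝔮 ∅ →+ unrSelmer κ ↥(V.endEigenPrimaryTorsion p π r) 𝔮 ∅)
        (addSubgroupOf_le_comap_conjUnr_sub_one κ ↥(V.endEigenPrimaryTorsion p π r) 𝔮 γ))) ∧
      padicValNat p (Nat.card (endInvariants (QuotientAddGroup.map _ _
        ((conjUnr κ ↥(V.endEigenPrimaryTorsion p π r) 𝔮 ∅ γ - 1 : AddMonoid.End (unrSelmer κ ↥(V.endEigenPrimaryTorsion p π r) 𝔮 ∅)) :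
          unrSelmer κ ↥(V.endEigenPrimaryTorsion p π r) 𝔮 ∅ →+ unrSelmer κ ↥(V.endEigenPrimaryTorsion p π r) 𝔮 ∅)
        (addSubgroupOf_le_comap_conjUnr_sub_one κ ↥(V.endEigenPrimaryTorsion p π r) 𝔮 γ)))) =
        e + padicValNat p (Nat.card (EndCoinvariants (QuotientAddGroup.map _ _
          ((conjUnr κ ↥(V.endEigenPrimaryTorsion p π r) 𝔮 ∅ γ - 1 : AddMonoid.End (unrSelmer κ ↥(V.endEigenPrimaryTorsion p π r) 𝔮 ∅)) :
            unrSelmer κ ↥(V.endEigenPrimaryTorsion p π r) 𝔮 ∅ →+ unrSelmer κ ↥(V.endEigenPrimaryTorsion p π r) 𝔮 ∅)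
          (addSubgroupOf_le_comap_conjUnr_sub_one κ ↥(V.endEigenPrimaryTorsion p π r) 𝔮 γ)))) ∧
      (PowerSeries.constantCoeff H').valuation = n + e :=
  exists_restrictedDualData_of_unr (RestrictedSelmerPair.exists_pow_smul_endEigenPrimaryTorsion_eq_zero V p π r)
    (RestrictedSelmerPair.isOpen_stabilizer_endEigenPrimaryTorsion V p π r) hγ Dnr hXtor hH' hH'0

/-- **Any-datum form for the CM summand**: for EVERY Agboola datum `D` of `𝔖_𝔮(K'_∞, W*)`, `Module.Finite D.X` and
`D.HasCharValuationAt n` with `ord_p H'(0) = n + e`, `v_p #Q^{ψ_Q} = e + v_p #Q_{ψ_Q}` (both finite). [cite: GreenbergVatsal2000, §2 Cor. 2.3]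
[cite: GreenbergLNM1716, §4 Lemma 4.2] -/
theorem hasCharValuationAt_restricted_of_unr_endEigenPrimaryTorsion (hγ : κ.IsTopGenerator γ)
    (Dnr : DatumDualData κ γ ↥(V.endEigenPrimaryTorsion p π r)
      (Castella2018.AcSelmer.bdpData ↥(V.endEigenPrimaryTorsion p π r) p 𝔮) ∅)
    [Module.Finite (IwasawaAlgebra p) Dnr.X] (hXtor : Module.IsTorsion (IwasawaAlgebra p) Dnr.X) {H' : IwasawaAlgebra p}
    (hH' : Module.charIdeal (IwasawaAlgebra p) Dnr.X = Ideal.span {H'}) (hH'0 : PowerSeries.constantCoeff H' ≠ 0)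
    (D : RestrictedDualData κ ↥(V.endEigenPrimaryTorsion p π r) 𝔮 γ) :
    Module.Finite (IwasawaAlgebra p) D.X ∧
    ∃ (n e : ℕ), D.HasCharValuationAt n ∧
      Finite (endInvariants (QuotientAddGroup.map _ _
        ((conjUnr κ ↥(V.endEigenPrimaryTorsion p π r) 𝔮 ∅ γ - 1 : AddMonoid.End (unrSelmer κ ↥(V.endEigenPrimaryTorsion p π r) 𝔮 ∅)) :
          unrSelmer κ ↥(V.endEigenPrimaryTorsion p π r) 𝔮 ∅ →+ unrSelmer κ ↥(V.endEigenPrimaryTorsion p π r) 𝔮 ∅)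
        (addSubgroupOf_le_comap_conjUnr_sub_one κ ↥(V.endEigenPrimaryTorsion p π r) 𝔮 γ))) ∧
      Finite (EndCoinvariants (QuotientAddGroup.map _ _
        ((conjUnr κ ↥(V.endEigenPrimaryTorsion p π r) 𝔮 ∅ γ - 1 : AddMonoid.End (unrSelmer κ ↥(V.endEigenPrimaryTorsion p π r) 𝔮 ∅)) :
          unrSelmer κ ↥(V.endEigenPrimaryTorsion p π r) 𝔮 ∅ →+ unrSelmer κ ↥(V.endEigenPrimaryTorsion p π r) 𝔮 ∅)
        (addSubgroupOf_le_comap_conjUnr_sub_one κ ↥(V.endEigenPrimaryTorsion p π r) 𝔮 γ))) ∧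
      padicValNat p (Nat.card (endInvariants (QuotientAddGroup.map _ _
        ((conjUnr κ ↥(V.endEigenPrimaryTorsion p π r) 𝔮 ∅ γ - 1 : AddMonoid.End (unrSelmer κ ↥(V.endEigenPrimaryTorsion p π r) 𝔮 ∅)) :
          unrSelmer κ ↥(V.endEigenPrimaryTorsion p π r) 𝔮 ∅ →+ unrSelmer κ ↥(V.endEigenPrimaryTorsion p π r) 𝔮 ∅)
        (addSubgroupOf_le_comap_conjUnr_sub_one κ ↥(V.endEigenPrimaryTorsion p π r) 𝔮 γ)))) =
        e + padicValNat p (Nat.card (EndCoinvariants (QuotientAddGroup.map _ _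
          ((conjUnr κ ↥(V.endEigenPrimaryTorsion p π r) 𝔮 ∅ γ - 1 : AddMonoid.End (unrSelmer κ ↥(V.endEigenPrimaryTorsion p π r) 𝔮 ∅)) :
            unrSelmer κ ↥(V.endEigenPrimaryTorsion p π r) 𝔮 ∅ →+ unrSelmer κ ↥(V.endEigenPrimaryTorsion p π r) 𝔮 ∅)
          (addSubgroupOf_le_comap_conjUnr_sub_one κ ↥(V.endEigenPrimaryTorsion p π r) 𝔮 γ)))) ∧
      (PowerSeries.constantCoeff H').valuation = n + e :=
  hasCharValuationAt_restricted_of_unr (RestrictedSelmerPair.exists_pow_smul_endEigenPrimaryTorsion_eq_zero V p π r)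
    (RestrictedSelmerPair.isOpen_stabilizer_endEigenPrimaryTorsion V p π r) hγ Dnr hXtor hH' hH'0 D

end Summand

/-! ## §5. The socket for the arithmetic half: transport of `χ_Γ(Q)` along an equivariant isomorphism `Q ≃ 𝓗` -/

section Socket

/-- **`#Q^{ψ} = #Q'^{ψ'}` and `#Q_{ψ} = #Q'_{ψ'}` along an equivariant isomorphism** `e : Q ≃+ Q'`, `e ∘ ψ = ψ' ∘ e` (invariants: `e` restricts
to `ker ψ ≃ ker ψ'`; coinvariants: `QuotientAddGroup.congr` with `e(ψ(Q)) = ψ'(Q')`). The transport step of GV Cor. 2.3 «`S^{Σ₀}_A/S_A ≅ ∏ 𝓗_ℓ` as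
`Λ`-modules» read on the two Euler characteristics. [cite: GreenbergVatsal2000, §2 Cor. 2.3 (pp. 20–21)] -/
theorem natCard_endInvariants_congr {Q Q' : Type*} [AddCommGroup Q] [AddCommGroup Q'] (e : Q ≃+ Q')
    (ψ : AddMonoid.End Q) (ψ' : AddMonoid.End Q') (h : ∀ q, e (ψ q) = ψ' (e q)) :
    Nat.card (endInvariants ψ) = Nat.card (endInvariants ψ') ∧
      Nat.card (EndCoinvariants ψ) = Nat.card (EndCoinvariants ψ') := by
  constructor
  · refine Nat.card_congr (e.toEquiv.subtypeEquiv fun q ↦ ?_)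
    change q ∈ endInvariants ψ ↔ e q ∈ endInvariants ψ'
    rw [mem_endInvariants_iff, mem_endInvariants_iff, ← h, ← map_zero e]
    exact e.injective.eq_iff.symm
  · have hmap : (AddMonoidHom.range (AddMonoidHomClass.toAddMonoidHom ψ)).map (e : Q →+ Q') =
        AddMonoidHom.range (AddMonoidHomClass.toAddMonoidHom ψ') := by
      ext x
      simp only [AddSubgroup.mem_map, AddMonoidHom.mem_range, AddMonoidHom.coe_coe]
      constructor
      · rintro ⟨y, ⟨q, rfl⟩, rfl⟩
        exact ⟨e q, by rw [← h]⟩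
      · rintro ⟨q', rfl⟩
        obtain ⟨q, rfl⟩ := e.surjective q'
        exact ⟨ψ q, ⟨q, rfl⟩, h q⟩
    exact Nat.card_congr (QuotientAddGroup.congr _ _ e hmap).toEquiv

variable {K : Type u} [Field K] [NumberField K] {p : ℕ} [Fact p.Prime] {κ : ZpExtension K p}
  {M : Type u} [AddCommGroup M] [DistribMulAction (absoluteGaloisGroup K) M] [TopologicalSpace M] [DiscreteTopology M]
  {𝔮 : HeightOneSpectrum (𝓞 K)} {γ : absoluteGaloisGroup K}

/-- **THE SOCKET FOR S3d's ARITHMETIC HALF: `ord_p H'(0) = n + χ(𝓗)` once `Q = S_nr ⧸ 𝔖 ≅ 𝓗` equivariantly.** Hypotheses of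
`hasCharValuationAt_restricted_of_unr`, plus ANY abelian group `H` with an endomorphism `ψ_H` and an additive isomorphism `e : Q ≃+ H` with
`e ∘ ψ_Q = ψ_H ∘ e` (the output shape of «(LS)-over-the-line ⟹ `Q = ⊕_{𝔓∣v̄} H¹_nr/H¹_str`», LEAD 02:08:52Z / -w7 g5, indexed as -w8 g4's (DC)
pleases): then `H^{ψ_H}`, `H_{ψ_H}` are FINITE, `v_p #H^{ψ_H} = e + v_p #H_{ψ_H}` and `ord_p H'(0) = n + e` with `D.HasCharValuationAt n` — so the
class value `e_δ` of `stub_strictDefectAtVbar_two` is -w6 g4's LOCAL count `log_p #𝓗^Γ − log_p #𝓗_Γ`.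
[cite: GreenbergVatsal2000, §2 Cor. 2.3 (pp. 20–21), Prop. 2.4 (p. 22)] [cite: GreenbergLNM1716, §4 Lemma 4.2] -/
theorem hasCharValuationAt_restricted_of_unr_of_addEquiv (htor : ∀ m : M, ∃ k : ℕ, p ^ k • m = 0)
    (hstab : ∀ m : M, IsOpen (MulAction.stabilizer (absoluteGaloisGroup K) m : Set (absoluteGaloisGroup K)))
    (hγ : κ.IsTopGenerator γ) (Dnr : DatumDualData κ γ M (Castella2018.AcSelmer.bdpData M p 𝔮) ∅)
    [Module.Finite (IwasawaAlgebra p) Dnr.X] (hXtor : Module.IsTorsion (IwasawaAlgebra p) Dnr.X) {H' : IwasawaAlgebra p}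
    (hH' : Module.charIdeal (IwasawaAlgebra p) Dnr.X = Ideal.span {H'}) (hH'0 : PowerSeries.constantCoeff H' ≠ 0)
    (D : RestrictedDualData κ M 𝔮 γ) {H : Type*} [AddCommGroup H] (ψH : AddMonoid.End H)
    (e : unrSelmer κ M 𝔮 ∅ ⧸ (restrictedSelmerZp κ M 𝔮).addSubgroupOf (unrSelmer κ M 𝔮 ∅) ≃+ H)
    (he : ∀ q, e (QuotientAddGroup.map _ _
        ((conjUnr κ M 𝔮 ∅ γ - 1 : AddMonoid.End (unrSelmer κ M 𝔮 ∅)) : unrSelmer κ M 𝔮 ∅ →+ unrSelmer κ M 𝔮 ∅)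
        (addSubgroupOf_le_comap_conjUnr_sub_one κ M 𝔮 γ) q) = ψH (e q)) :
    Module.Finite (IwasawaAlgebra p) D.X ∧
    ∃ (n e : ℕ), D.HasCharValuationAt n ∧ Finite (endInvariants ψH) ∧ Finite (EndCoinvariants ψH) ∧
      padicValNat p (Nat.card (endInvariants ψH)) = e + padicValNat p (Nat.card (EndCoinvariants ψH)) ∧
      (PowerSeries.constantCoeff H').valuation = n + e := by
  obtain ⟨hfin, n, e', h1, h2, h3, h4, h5⟩ := hasCharValuationAt_restricted_of_unr htor hstab hγ Dnr hXtor hH' hH'0 D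
  obtain ⟨hI, hC⟩ := natCard_endInvariants_congr e _ ψH he
  haveI := h2; haveI := h3
  refine ⟨hfin, n, e', h1, ?_, ?_, ?_, h5⟩
  · exact Nat.finite_of_card_ne_zero (hI ▸ Nat.card_pos.ne')
  · exact Nat.finite_of_card_ne_zero (hC ▸ Nat.card_pos.ne')
  · rw [← hI, ← hC]; exact h4

end Socket

end Summit.BirchSwinnertonDyer.BirchSwinnertonDyer.Theorems.PrintCf2.StrictDefect

end
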